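import Literature.MathematicalPhysics.QuantumFieldTheory.Balaban1983to89.B9Ineq346SecondOrderTorusCutoff
import Literature.MathematicalPhysics.QuantumFieldTheory.Balaban1983to89.B9Ineq347GpFlatMultiLevelTorus

/-!
# `Balaban1983to89.B9Ineq346SecondOrderFlatMultiLevelTorus` — [B9] (3.46) AT `U = 1`: THE THREE SECOND-ORDER `L²`
MEMBERS OF THEOREM 3.1 FOR THE SCALAR PROPAGATOR `G′ = Δ′_a⁻¹` ON THE GENUINE `k`-LEVEL TORUS, FILE 3a: the members
`∇∇G′` and `G′∇*∇*` — for `supp λ ⊂ B(y′)`: `Σ_{x∈B(y)}((∂_μ∂_νG′λ)(x))², Σ_{x∈B(y)}((G′∂_μᵀ∂_νᵀλ)(x))² ≤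
C·e^{−δd(y,y′)}·Σλ²` (cell GAP G-B9-03a: «(3.46) at U = 1 is not printed in [4]», the members with NO sup majorant in
[4]; file 3a of the second-order programme of seat dag-n06-h g3; the member `∇G′∇*` is file 3b
`B9Ineq346SecondOrderCaccioppoliTorus`; no existing module is touched; no fact is minted)

T. Bałaban, *Propagators for lattice gauge theories in a background field*, Commun. Math. Phys. **99** (1985) 389–434
[`Balaban1985BackgroundPropagators`, "B9"]; [4] = T. Bałaban, *Propagators and renormalization transformations for lattice
gauge theories. II*, Commun. Math. Phys. **96** (1984) 223–250 [`Balaban1984PropagatorsII`].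

statement-level skeleton of published theorems with citation tags; proofs where landed; nothing here is a claim about the
Yang–Mills mass gap

THE PRINTED LOCI (verbatim).  (3.46), p. 398: *"… ‖h∇_UG′(U)∇\*_Uλ‖, ‖h∇_U∇_UG′(U)λ‖, ‖hG′(U)∇\*_U∇\*_Uλ‖ ≦ B₀[…, 1, 1, 1]
|h|e^{−δ₀d(y,y′)}‖λ‖ for supp h ⊂ Δ̃(y), y ∈ Λ_j, supp λ ⊂ Δ(y′)"*; *"we may always replace ∇_U by ∇\*_U"*; Cor. 3.5
p. 407: *"For … U = 1, these theorems are proved in [4]"* — [4] Prop. 2.2 (2.67) prints the sup ∕ Hölder members only.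

THE ROUTE (kernel-checked; `U = 1`, lattice units of the torus lineage `B6MultiLevelTorusOperator`, blocks `𝔅` and
`d = d_T` of `B6Geom246MultiLevelTorus`).  Let `χ = χ_y` be the block-scale cut-off of `B9Ineq346SecondOrderTorusCutoff`
(`= 1` on `B(y)` and its 2-neighbourhood, `|∂χ| ≤ 2L^{−j}`, `|Δχ| ≤ 2(d+1)L^{−2j}`, supported over the blocks at
`d ≤ K₀` of `y`, levels there within `j ± 1`), `u = G′λ` (resp. `G′∂_νᵀλ`), `𝒩 = {s : d(s, y) ≤ K₀ + 1}`.
* `∂_μ∂_νG′` (§3): `1_{B(y)}∂_μ∂_νu = 1_{B(y)}∂_μ∂_ν(χu)`; the torus H² identity `‖∂_μ∂_ν(χu)‖ ≤ ‖Δ(χu)‖`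
  (`B9Ineq346SecondOrderTorusCore.sq_dT_dT_le_sq_perLapT`); `Δ(χu) = χ(Vu − λ) − uΔχ + B(χ,u)` (`Δ′_au = λ`,
  `Δ′_a = −Δ + V`); the four pieces are `λ` near `y` (else `0`), `L^{−2j_s}‖1_su‖` (`sum_sq_V_le`), `L^{−2j}‖1_𝒩u‖`,
  `L^{−j}‖1_𝒩∂u‖` (`sum_commB_sq_le`) — bounded by lit-balaban-p21's PROVED members `‖1_sG′1_{y′}‖ ≤ CL^{j_s+j′}e^{−δd}`,
  `‖1_s∂G′1_{y′}‖ ≤ CL^{(j_s+j′)/2}e^{−δd}` (`ineq346_Gp∕dGp_flat_multiLevelTorus`); the surplus `L^{j′−j}` is paid by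
  (2.60) (`transfer_rpow`), the count `#𝒩` by (2.61) (`consts_260_261`).
* `G′∂_μᵀ∂_νᵀ = (∂_ν∂_μG′)ᵀ` (§4): `transpose_block_bound`.
* `∂_μG′∂_νᵀ`: the discrete Caccioppoli inequality — in the sequel file `B9Ineq346SecondOrderCaccioppoliTorus`.

## WHAT THIS FILE CERTIFIES

* §1 helpers (the near-block set `𝒩`, its count, the one-step closure of the cut-off's support, level windows, decay
  transfer), §2 the operator facts (`Δ′_a[a′]G′[a] = 1` with the weights repaired at level 0, `−ΔG′λ = λ − VG′λ`);
* §3 ★ `ineq346_ddGp_flat_multiLevelTorus` (with the local estimate `ddGp_local_estimate`), §4 ★ `ineq346_Gpdd_flat_multiLevelTorus`;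
  the member `∂_μG′∂_νᵀ` (★ `ineq346_dGpd_flat_multiLevelTorus`) is the sequel file `B9Ineq346SecondOrderCaccioppoliTorus`
  — `k`-uniform `δ, C, M₀, N₀` (functions of `d, ℓ` and the weight windows only) with
  `Σ_{x∈B(y)}((T λ)(x))² ≤ C·e^{−δd_T(y,y′)}·Σλ²` for `T = ∂_μ∂_νG′, ∂_μG′∂_νᵀ, G′∂_μᵀ∂_νᵀ`, every torus family `D`,
  blocks `y, y′` and `λ = 0` off `B(y′)`; hypotheses VERBATIM those of p21's members (`M_h ≥ 3`, `R ≥ 2L`, `P_μ ≥ 4`, the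
  weight windows and recursion).

## HONEST SCOPE

`U = 1` only; one-block cut-off ∕ support (print's `Δ̃(y)`, `Δ(y′)` are bounded unions of blocks; the block version is the
atomic case); squared form; lattice units (prefactor `1` as printed: the `η`'s cancel); `∂` = the periodic forward difference.
The analytic inputs are p21's members 0, 1, 2 and Lemma 2.1; the local energy estimates are those of the Core file.  Nothing
is inferred from the manuscript: every step is kernel-checked.  One finite lattice programme — nothing continuum, nothing
about the mass gap.  Cell `pub-ymgap` (HUMAN RULING D-0062), Track A node N06 [B9], N06-ASSIGNMENT v1 row 11 (bundle F3) at
def-Y's instance, seat `pub-ymgap-dag-n06-h` (g3), 2026-08-27.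
-/

noncomputable section

namespace Literature.MathematicalPhysics.QuantumFieldTheory.Balaban1983to89.B9Ineq346SecondOrderFlatMultiLevelTorus

open Finset Matrix
open B4Reflection242 (boxDom mem_boxDom)
open B4ContourShift (supNorm)
open B4TorusKernel.MultiPeriod (torusSupNorm torusSupNorm_le_supNorm torusSupNorm_translate translate)
open B6MultiLevelBoxOperator (N0 levC)
open B6MultiLevelTorusOperator
open B6Prop22DerivMultiLevelTorus (dT dT_mulVec)
open B6Geom246MultiLevelBox (bset blkOf scale_bounds)
open B6Geom246MultiLevelTorus (bondT TouchT bondT_adj connectedT geomT)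
open B6Ineq243TwoLevelBox (aNext)
open B6Lemma21Repaired (Ineq261With)
open B6Prop22MultiLevelTorus (mlOpT_congr_weights)
open B9Thm314GpFlatMultiLevelTorus (consts_260_261)
open B9Ineq347GpFlatMultiLevelTorus (transfer_rpow)
open B9Ineq346GpFlatMultiLevelTorus (ineq346_Gp_flat_multiLevelTorus ineq346_dGp_flat_multiLevelTorus
  ineq346_Gpd_flat_multiLevelTorus)
open B9Ineq346SecondOrderTorusCore
open B9Ineq346SecondOrderTorusCutoff

variable {d : ℕ}

/-! ## §1 Helpers: near blocks, their count, one lattice step, level windows -/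

section Helpers

variable {ℓ Mh k R : ℕ} {P : Fin (d + 1) → ℕ} (D : TDomains d ℓ Mh k P R)

/-- the torus distance of a site to its `±e_μ`-translate is `≤ 1`. [cite: Balaban1983RegularityDecay, p.572 («periodic conditions»), dictionary] -/
theorem torusSupNorm_tshift_unit_le (hMh : 1 ≤ Mh) (hP : ∀ μ, 1 ≤ P μ) (x : ↥(boxDom (N0 ℓ Mh k P))) (μ : Fin (d + 1))
    (ε : ℤ) (hε : |ε| ≤ 1) :
    torusSupNorm (N0 ℓ Mh k P) (x.1 - (tshift (N0 ℓ Mh k P) (ε • unitVec μ) x).1) ≤ 1 := by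
  obtain ⟨m, hm⟩ := tshift_val_eq_translate (N0 ℓ Mh k P) (ε • unitVec μ) x
  have e : x.1 - (tshift (N0 ℓ Mh k P) (ε • unitVec μ) x).1 = translate (N0 ℓ Mh k P) (-(ε • unitVec μ)) (-m) := by
    rw [hm]; funext i
    simp only [Pi.sub_apply, B4TorusKernel.MultiPeriod.translate_apply, Pi.add_apply, Pi.neg_apply]; ring
  rw [e, torusSupNorm_translate]
  refine (torusSupNorm_le_supNorm (one_le_N0 hMh hP) _).trans ?_
  unfold supNorm; rw [Finset.sup'_le_iff]
  intro i _
  have : |(-(ε • unitVec (d := d) μ)) i| ≤ 1 := by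
    simp only [Pi.neg_apply, Pi.smul_apply, unitVec, Pi.single_apply, smul_eq_mul, abs_neg]
    split_ifs <;> simp [hε]
  exact_mod_cast this

/-- **one lattice step moves the block by at most one bond**: `d(y(x), y(x ± e_μ)) ≤ 1`. [cite: Balaban1984PropagatorsII, (2.46) p.231, dictionary] -/
theorem distT_tshift_unit_le_one (hMh : 1 ≤ Mh) (hP : ∀ μ, 1 ≤ P μ) (x : ↥(boxDom (N0 ℓ Mh k P))) (μ : Fin (d + 1))
    (ε : ℤ) (hε : |ε| ≤ 1) :
    (bondT D).dist (blkOf D.toDomains x) (blkOf D.toDomains (tshift (N0 ℓ Mh k P) (ε • unitVec μ) x)) ≤ 1 := by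
  by_cases he : blkOf D.toDomains x = blkOf D.toDomains (tshift (N0 ℓ Mh k P) (ε • unitVec μ) x)
  · rw [he, SimpleGraph.dist_self]; exact zero_le_one
  · rw [SimpleGraph.dist_eq_one_iff_adj.2 (bondT_adj.2 ⟨he, x, _, rfl, rfl, torusSupNorm_tshift_unit_le hMh hP x μ ε hε⟩)]

/-- the blocks at `d`-distance `≤ K` from `y`. [cite: Balaban1984PropagatorsII, (2.46) p.231, dictionary] -/
theorem mem_near_iff (y s : ↥(bset D.toDomains)) (K : ℕ) :
    s ∈ Finset.univ.filter (fun s => (bondT D).dist s y ≤ K) ↔ (bondT D).dist s y ≤ K := by simp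

/-- **THE COUNT OF NEAR BLOCKS** from (2.61): `#{s : d(s,y) ≤ K} ≤ c·e^{αδK}`. [cite: Balaban1984PropagatorsII, Lemma 2.1 (2.61) p.234] -/
theorem card_near_le {c δ α : ℝ} (hδ : 0 ≤ α * δ) (h261 : Ineq261With c (geomT D) δ α) (y : ↥(bset D.toDomains)) (K : ℕ) :
    (((Finset.univ.filter (fun s : ↥(bset D.toDomains) => (bondT D).dist s y ≤ K)).card : ℕ) : ℝ)
      ≤ c * Real.exp (α * δ * K) := by
  have h := h261 y
  have hK : ∀ s ∈ Finset.univ.filter (fun s : ↥(bset D.toDomains) => (bondT D).dist s y ≤ K),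
      Real.exp (-(α * δ * K)) ≤ Real.exp (-(α * δ * (geomT D).dist y s)) := by
    intro s hs
    have hs' : ((bondT D).dist s y : ℝ) ≤ K := by exact_mod_cast (Finset.mem_filter.1 hs).2
    have e : (geomT D).dist y s = ((bondT D).dist s y : ℝ) := by
      show (((bondT D).dist y s : ℕ) : ℝ) = _; rw [SimpleGraph.dist_comm]
    rw [e]
    exact Real.exp_le_exp.2 (by nlinarith)
  have h1 : (((Finset.univ.filter (fun s : ↥(bset D.toDomains) => (bondT D).dist s y ≤ K)).card : ℕ) : ℝ)
      * Real.exp (-(α * δ * K)) ≤ ∑ s : ↥(bset D.toDomains), Real.exp (-(α * δ * (geomT D).dist y s)) := by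
    calc _ = ∑ s ∈ Finset.univ.filter (fun s : ↥(bset D.toDomains) => (bondT D).dist s y ≤ K), Real.exp (-(α * δ * K)) := by
          rw [Finset.sum_const, nsmul_eq_mul]
      _ ≤ ∑ s ∈ Finset.univ.filter (fun s : ↥(bset D.toDomains) => (bondT D).dist s y ≤ K),
            Real.exp (-(α * δ * (geomT D).dist y s)) := Finset.sum_le_sum hK
      _ ≤ _ := Finset.sum_le_sum_of_subset_of_nonneg (Finset.filter_subset _ _) fun _ _ _ => (Real.exp_pos _).le
  have h2 := h1.trans h
  rw [← le_div_iff₀ (Real.exp_pos _)] at h2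
  rwa [div_eq_mul_inv, ← Real.exp_neg, neg_neg] at h2

/-- decay transfer to a near block: `d(s,y) ≤ K ⇒ e^{−δd(s,y′)} ≤ e^{δK}·e^{−δd(y,y′)}` (triangle inequality).
[cite: Balaban1984PropagatorsII, (2.54) p.232] -/
theorem exp_near_le (hMh : 1 ≤ Mh) (hP : ∀ μ, 1 ≤ P μ) {δ : ℝ} (hδ : 0 ≤ δ) (y y' s : ↥(bset D.toDomains)) {K : ℕ}
    (hs : (bondT D).dist s y ≤ K) :
    Real.exp (-(δ * (geomT D).dist s y')) ≤ Real.exp (δ * K) * Real.exp (-(δ * (geomT D).dist y y')) := by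
  rw [← Real.exp_add]
  refine Real.exp_le_exp.2 ?_
  have htri := (connectedT (D := D) hMh hP).dist_triangle (u := y) (v := s) (w := y')
  rw [SimpleGraph.dist_comm] at hs
  have h1 : ((bondT D).dist y y' : ℝ) ≤ K + (bondT D).dist s y' := by
    have : ((bondT D).dist y y' : ℝ) ≤ (((bondT D).dist y s + (bondT D).dist s y' : ℕ) : ℝ) := by exact_mod_cast htri
    push_cast at this
    have hs' : ((bondT D).dist y s : ℝ) ≤ K := by exact_mod_cast hs
    linarith
  show -(δ * (((bondT D).dist s y' : ℕ) : ℝ)) ≤ δ * K + -(δ * (((bondT D).dist y y' : ℕ) : ℝ))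
  nlinarith

/-- powers of `L` at a level within one of `j`: `L^{j_s} ≤ L·L^j` and `L^{−j_s}… `: `L^j ≤ L·L^{j_s}`.
[cite: Balaban1984PropagatorsII, (2.2) p.224, dictionary] -/
theorem pow_window {j js : ℕ} (h1 : j ≤ js + 1) (h2 : js ≤ j + 1) :
    ((ℓ : ℝ) + 1) ^ js ≤ ((ℓ : ℝ) + 1) * ((ℓ : ℝ) + 1) ^ j ∧ ((ℓ : ℝ) + 1) ^ j ≤ ((ℓ : ℝ) + 1) * ((ℓ : ℝ) + 1) ^ js := by
  have hL1 : (1 : ℝ) ≤ (ℓ : ℝ) + 1 := by linarith [(Nat.cast_nonneg ℓ : (0 : ℝ) ≤ ℓ)]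
  constructor
  · rw [← pow_succ']; exact pow_le_pow_right₀ hL1 h2
  · rw [← pow_succ']; exact pow_le_pow_right₀ hL1 h1

end Helpers

/-! ## §2 The operator facts at `U = 1` -/

section Operator

variable {ℓ Mh k R : ℕ} {P : Fin (d + 1) → ℕ} (D : TDomains d ℓ Mh k P R)

/-- the weights repaired at level `0` (never used: all levels are `≥ 1`). [cite: Balaban1984PropagatorsII, (2.14) p.225, dictionary] -/
theorem weights_repaired {a : ℕ → ℝ} {aminus aplus : ℝ} (ha : 0 < aminus)
    (haw : ∀ i, 1 ≤ i → aminus ≤ a i ∧ a i ≤ aplus) :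
    (∀ j, 0 ≤ (fun j => if j = 0 then (1 : ℝ) else a j) j) ∧ (∀ j, 0 < (fun j => if j = 0 then (1 : ℝ) else a j) j) ∧
      (∀ j, 1 ≤ j → (fun j => if j = 0 then (1 : ℝ) else a j) j = a j) ∧
      (∀ j, 1 ≤ j → (fun j => if j = 0 then (1 : ℝ) else a j) j ≤ aplus) := by
  refine ⟨fun j => ?_, fun j => ?_, fun j hj => ?_, fun j hj => ?_⟩
  · dsimp only; split_ifs with h
    · exact zero_le_one
    · exact (ha.le.trans (haw j (Nat.pos_of_ne_zero h)).1)
  · dsimp only; split_ifs with h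
    · exact zero_lt_one
    · exact (ha.trans_le (haw j (Nat.pos_of_ne_zero h)).1)
  · dsimp only; rw [if_neg (by omega)]
  · dsimp only; rw [if_neg (by omega)]; exact (haw j hj).2

/-- **`Δ′_a[a′]·G′[a] = 1`** for the repaired weights `a′` (the operator only sees levels `≥ 1`).
[cite: Balaban1984PropagatorsII, p.225 («G′ = Δ′_a^{−1} is a well defined … operator»)] -/
theorem mlOpT_repaired_mulVec_gmlT (hMh : 1 ≤ Mh) (hP : ∀ μ, 1 ≤ P μ) {a a' : ℕ → ℝ} (ha' : ∀ j, 0 < a' j)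
    (haa' : ∀ j, 1 ≤ j → a' j = a j) (g : ↥(boxDom (N0 ℓ Mh k P)) → ℝ) :
    mlOpT (N0 ℓ Mh k P) ℓ k D.lev a' *ᵥ (gmlT (N0 ℓ Mh k P) ℓ k D.lev a *ᵥ g) = g := by
  have hG : gmlT (N0 ℓ Mh k P) ℓ k D.lev a = gmlT (N0 ℓ Mh k P) ℓ k D.lev a' := by
    unfold gmlT; rw [mlOpT_congr_weights (N := N0 ℓ Mh k P) (ℓ := ℓ) (k := k) D.one_le_lev (fun j hj => (haa' j hj).symm)]
  rw [hG, Matrix.mulVec_mulVec, mlOpT_mul_gmlT (one_le_N0 hMh hP) D.lev_le ha', Matrix.one_mulVec]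

/-- **`(−ΔG′g)(x) = g(x) − (VG′g)(x)`** with `V` the averaging part at the repaired weights.
[cite: Balaban1984PropagatorsII, (2.13)–(2.14) p.225] -/
theorem perLapT_gmlT_apply (hMh : 1 ≤ Mh) (hP : ∀ μ, 1 ≤ P μ) {a a' : ℕ → ℝ} (ha' : ∀ j, 0 < a' j)
    (haa' : ∀ j, 1 ≤ j → a' j = a j) (g : ↥(boxDom (N0 ℓ Mh k P)) → ℝ) (x : ↥(boxDom (N0 ℓ Mh k P))) :
    (perLapT (N0 ℓ Mh k P) *ᵥ (gmlT (N0 ℓ Mh k P) ℓ k D.lev a *ᵥ g)) x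
      = g x - levC d ℓ a' (D.lev x.1) * ∑ y ∈ Finset.univ.filter (fun y => blkOf D.toDomains y = blkOf D.toDomains x),
          (gmlT (N0 ℓ Mh k P) ℓ k D.lev a *ᵥ g) y := by
  have h := mlOpT_mulVec_eq D a' (gmlT (N0 ℓ Mh k P) ℓ k D.lev a *ᵥ g) x
  rw [mlOpT_repaired_mulVec_gmlT D hMh hP ha' haa'] at h
  linarith

end Operator

/-! ## §3 The member `∂_μ∂_νG′`: the local H² estimate -/

section MemberDD

variable {ℓ Mh k R : ℕ} {P : Fin (d + 1) → ℕ} (D : TDomains d ℓ Mh k P R)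

/-- the mixed second difference at a site: `(∂_μ∂_νw)(x) = w(x+e_μ+e_ν) − w(x+e_μ) − w(x+e_ν) + w(x)`.
[cite: Balaban1985BackgroundPropagators, (3.46) p.398 (the member ∇∇G′), dictionary] -/
theorem dT_dT_mulVec_apply (μ ν : Fin (d + 1)) (w : ↥(boxDom (N0 ℓ Mh k P)) → ℝ) (x : ↥(boxDom (N0 ℓ Mh k P))) :
    ((dT (N0 ℓ Mh k P) μ * dT (N0 ℓ Mh k P) ν) *ᵥ w) x
      = w (tshift (N0 ℓ Mh k P) (unitVec ν) (tshift (N0 ℓ Mh k P) (unitVec μ) x))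
        - w (tshift (N0 ℓ Mh k P) (unitVec μ) x) - w (tshift (N0 ℓ Mh k P) (unitVec ν) x) + w x := by
  rw [← Matrix.mulVec_mulVec, dT_mulVec, dT_mulVec, dT_mulVec]; ring

/-- **the support of the cut-off and of its lattice translates, in block terms**: if `χ_y(x + εe_μ) ≠ 0` (`|ε| ≤ 1`) then
`d(y(x), y) ≤ K₀ + 1`, `K₀ = (d+1)(4L+1)`. [cite: Balaban1985BackgroundPropagators, (3.46) p.398 («supp h ⊂ Δ̃(y)»); Balaban1984PropagatorsII, (2.46) p.231] -/
theorem distT_le_of_cutoffT_tshift_ne_zero (hℓ : 1 ≤ ℓ) (hMh : 3 ≤ Mh) (hR : 2 * (ℓ + 1) ≤ R) (hP4 : ∀ μ, 4 ≤ P μ)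
    (y : ↥(bset D.toDomains)) (x : ↥(boxDom (N0 ℓ Mh k P))) (μ : Fin (d + 1)) (ε : ℤ) (hε : |ε| ≤ 1)
    (hx : cutoffT D y (tshift (N0 ℓ Mh k P) (ε • unitVec μ) x) ≠ 0) :
    (bondT D).dist (blkOf D.toDomains x) y ≤ (d + 1) * (4 * (ℓ + 1) + 1) + 1 := by
  have hMh1 : 1 ≤ Mh := le_trans (by norm_num) hMh
  have hP : ∀ μ, 1 ≤ P μ := fun μ => le_trans (by norm_num) (hP4 μ)
  have h1 := distT_le_of_cutoffT_ne_zero D y hℓ hMh hR hP4 hx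
  have h2 := distT_tshift_unit_le_one D hMh1 hP x μ ε hε
  have htri := (connectedT (D := D) hMh1 hP).dist_triangle (u := blkOf D.toDomains x)
    (v := blkOf D.toDomains (tshift (N0 ℓ Mh k P) (ε • unitVec μ) x)) (w := y)
  omega

/-- `(a − b + c − e)² ≤ 4(a² + b² + c² + e²)`. [folklore] -/
private theorem sq_four_le (a b c e : ℝ) : (a - b + c - e) ^ 2 ≤ 4 * (a ^ 2 + b ^ 2 + c ^ 2 + e ^ 2) := by
  nlinarith [sq_nonneg (a + b), sq_nonneg (a - c), sq_nonneg (a + e), sq_nonneg (b + c), sq_nonneg (b - e), sq_nonneg (c + e)]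

/-- ★ **THE LOCAL H² ESTIMATE FOR `∂_μ∂_νu` ON A BLOCK** (all constants explicit, no decay yet): for ANY `u`, `λ` with
`−Δu = λ − Vu` (`V` the averaging part at weights `a′ ≥ 0` — e.g. `u = G′λ`), with `χ = χ_y`, `𝒩 = {s : d(s,y) ≤ K₀+1}`:
`Σ_{x∈B(y)}((∂_μ∂_νu)(x))² ≤ 4·[Σχ²λ² + Σ_{s∈𝒩}(a′_{j_s}L^{−2j_s})²‖1_su‖² + (2(d+1)L^{−2j})²‖1_𝒩u‖² + 16(d+1)L^{−2j}Σ_{μ′}‖1_𝒩∂_{μ′}u‖²]`.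
[cite: Balaban1985BackgroundPropagators, (3.46) p.398 (the member ∇∇G′ at U = 1); Balaban1984PropagatorsII, (2.13)–(2.14) p.225] -/
theorem ddGp_local_estimate (hℓ : 1 ≤ ℓ) (hMh : 3 ≤ Mh) (hR : 2 * (ℓ + 1) ≤ R) (hP4 : ∀ μ, 4 ≤ P μ)
    {a' : ℕ → ℝ} (ha'0 : ∀ j, 0 ≤ a' j) (μ ν : Fin (d + 1)) (y : ↥(bset D.toDomains))
    (u lam : ↥(boxDom (N0 ℓ Mh k P)) → ℝ)
    (hLu : ∀ x, (perLapT (N0 ℓ Mh k P) *ᵥ u) x = lam x - levC d ℓ a' (D.lev x.1)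
      * ∑ z ∈ Finset.univ.filter (fun z => blkOf D.toDomains z = blkOf D.toDomains x), u z) :
    ∑ x ∈ Finset.univ.filter (fun x => blkOf D.toDomains x = y), (((dT (N0 ℓ Mh k P) μ * dT (N0 ℓ Mh k P) ν) *ᵥ u) x) ^ 2
      ≤ 4 * ((∑ x, cutoffT D y x ^ 2 * lam x ^ 2)
        + (∑ s ∈ Finset.univ.filter (fun s => (bondT D).dist s y ≤ (d + 1) * (4 * (ℓ + 1) + 1) + 1),
            (a' s.1.1 * ((((ℓ : ℝ) + 1) ^ s.1.1) ^ 2)⁻¹) ^ 2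
              * ∑ x ∈ Finset.univ.filter (fun x => blkOf D.toDomains x = s), u x ^ 2)
        + (2 * ((d : ℝ) + 1) / ((side D y : ℝ) ^ 2)) ^ 2
            * ∑ s ∈ Finset.univ.filter (fun s => (bondT D).dist s y ≤ (d + 1) * (4 * (ℓ + 1) + 1) + 1),
              ∑ x ∈ Finset.univ.filter (fun x => blkOf D.toDomains x = s), u x ^ 2
        + 4 * ((d : ℝ) + 1) * (2 / (side D y : ℝ)) ^ 2 * ∑ μ' : Fin (d + 1),
            ∑ s ∈ Finset.univ.filter (fun s => (bondT D).dist s y ≤ (d + 1) * (4 * (ℓ + 1) + 1) + 1),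
              ∑ x ∈ Finset.univ.filter (fun x => blkOf D.toDomains x = s), ((dT (N0 ℓ Mh k P) μ' *ᵥ u) x) ^ 2) := by
  classical
  have hMh1 : 1 ≤ Mh := le_trans (by norm_num) hMh
  have hP : ∀ μ, 1 ≤ P μ := fun μ => le_trans (by norm_num) (hP4 μ)
  set χ : ↥(boxDom (N0 ℓ Mh k P)) → ℝ := cutoffT D y with hχ
  set 𝒩 := Finset.univ.filter (fun s : ↥(bset D.toDomains) => (bondT D).dist s y ≤ (d + 1) * (4 * (ℓ + 1) + 1) + 1) with h𝒩
  -- support bookkeeping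
  have hnear : ∀ (x : ↥(boxDom (N0 ℓ Mh k P))) (μ' : Fin (d + 1)) (ε : ℤ), |ε| ≤ 1 →
      χ (tshift (N0 ℓ Mh k P) (ε • unitVec μ') x) ≠ 0 → blkOf D.toDomains x ∈ 𝒩 := by
    intro x μ' ε hε hx
    rw [h𝒩, Finset.mem_filter]
    exact ⟨Finset.mem_univ _, distT_le_of_cutoffT_tshift_ne_zero D hℓ hMh hR hP4 y x μ' ε hε hx⟩
  have hnear0 : ∀ x : ↥(boxDom (N0 ℓ Mh k P)), χ x ≠ 0 → blkOf D.toDomains x ∈ 𝒩 := by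
    intro x hx
    refine hnear x μ 0 (by simp) ?_
    rwa [zero_smul, tshift_zero]
  -- (a) the plateau: on `B(y)` the mixed difference of `u` is that of `v = χu`
  have hplat : ∀ x ∈ Finset.univ.filter (fun x => blkOf D.toDomains x = y),
      (((dT (N0 ℓ Mh k P) μ * dT (N0 ℓ Mh k P) ν) *ᵥ u) x) ^ 2
        = (((dT (N0 ℓ Mh k P) μ * dT (N0 ℓ Mh k P) ν) *ᵥ (fun z => χ z * u z)) x) ^ 2 := by
    intro x hx
    have hxy : blkOf D.toDomains x = y := (Finset.mem_filter.1 hx).2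
    obtain ⟨h0, hμ1, hμν⟩ := cutoffT_plateau_shifts D y hMh1 hP hxy μ ν
    obtain ⟨-, hν1, -⟩ := cutoffT_plateau_shifts D y hMh1 hP hxy ν ν
    have h0' : χ x = 1 := h0
    have hμ1' : χ (tshift (N0 ℓ Mh k P) (unitVec μ) x) = 1 := hμ1
    have hν1' : χ (tshift (N0 ℓ Mh k P) (unitVec ν) x) = 1 := hν1
    have hμν' : χ (tshift (N0 ℓ Mh k P) (unitVec ν) (tshift (N0 ℓ Mh k P) (unitVec μ) x)) = 1 := hμν
    rw [dT_dT_mulVec_apply, dT_dT_mulVec_apply, h0', hμ1', hν1', hμν']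
    ring
  rw [Finset.sum_congr rfl hplat]
  -- (b) the H² identity
  refine ((Finset.sum_le_sum_of_subset_of_nonneg (Finset.filter_subset _ _) fun _ _ _ => sq_nonneg _).trans
    (sq_dT_dT_le_sq_perLapT (N0 ℓ Mh k P) μ ν _)).trans ?_
  -- (c) the product rule and the equation, pointwise
  have hpt : ∀ x, ((perLapT (N0 ℓ Mh k P) *ᵥ (fun z => χ z * u z)) x) ^ 2 ≤ 4 * ((χ x * lam x) ^ 2
      + (χ x * (levC d ℓ a' (D.lev x.1) * ∑ z ∈ Finset.univ.filter (fun z => blkOf D.toDomains z = blkOf D.toDomains x), u z)) ^ 2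
      + (u x * (perLapT (N0 ℓ Mh k P) *ᵥ χ) x) ^ 2
      + (∑ μ' : Fin (d + 1), ((χ (tshift (N0 ℓ Mh k P) (unitVec μ') x) - χ x) * (u (tshift (N0 ℓ Mh k P) (unitVec μ') x) - u x)
          + (χ (tshift (N0 ℓ Mh k P) (-unitVec μ') x) - χ x) * (u (tshift (N0 ℓ Mh k P) (-unitVec μ') x) - u x))) ^ 2) := by
    intro x
    rw [perLapT_mulVec_mul (N0 ℓ Mh k P) χ u x, hLu x]
    calc _ = (χ x * lam x - χ x * (levC d ℓ a' (D.lev x.1)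
              * ∑ z ∈ Finset.univ.filter (fun z => blkOf D.toDomains z = blkOf D.toDomains x), u z)
            + u x * (perLapT (N0 ℓ Mh k P) *ᵥ χ) x
            - ∑ μ' : Fin (d + 1), ((χ (tshift (N0 ℓ Mh k P) (unitVec μ') x) - χ x) * (u (tshift (N0 ℓ Mh k P) (unitVec μ') x) - u x)
              + (χ (tshift (N0 ℓ Mh k P) (-unitVec μ') x) - χ x) * (u (tshift (N0 ℓ Mh k P) (-unitVec μ') x) - u x))) ^ 2 := by
          ring
      _ ≤ _ := sq_four_le _ _ _ _
  refine (Finset.sum_le_sum fun x _ => hpt x).trans ?_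
  rw [← Finset.mul_sum, Finset.sum_add_distrib, Finset.sum_add_distrib, Finset.sum_add_distrib]
  refine mul_le_mul_of_nonneg_left ?_ (by norm_num)
  -- (d) the four sums
  have hχ0 : ∀ x, 0 ≤ χ x := cutoffT_nonneg D y
  have hχ1 : ∀ x, χ x ≤ 1 := cutoffT_le_one D y
  have hT1 : ∑ x, (χ x * lam x) ^ 2 = ∑ x, χ x ^ 2 * lam x ^ 2 := Finset.sum_congr rfl fun x _ => by ring
  have hT2 : ∑ x, (χ x * (levC d ℓ a' (D.lev x.1)
        * ∑ z ∈ Finset.univ.filter (fun z => blkOf D.toDomains z = blkOf D.toDomains x), u z)) ^ 2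
      ≤ ∑ s ∈ 𝒩, (a' s.1.1 * ((((ℓ : ℝ) + 1) ^ s.1.1) ^ 2)⁻¹) ^ 2
          * ∑ x ∈ Finset.univ.filter (fun x => blkOf D.toDomains x = s), u x ^ 2 := by
    have := sum_sq_V_le D a' ha'0 χ u 𝒩 hχ0 hχ1 hnear0
    exact le_trans (le_of_eq (Finset.sum_congr rfl fun x _ => by ring)) this
  have hT3 : ∑ x, (u x * (perLapT (N0 ℓ Mh k P) *ᵥ χ) x) ^ 2
      ≤ (2 * ((d : ℝ) + 1) / ((side D y : ℝ) ^ 2)) ^ 2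
          * ∑ s ∈ 𝒩, ∑ x ∈ Finset.univ.filter (fun x => blkOf D.toDomains x = s), u x ^ 2 := by
    have hloc := sum_weight_le D (fun x => ((perLapT (N0 ℓ Mh k P) *ᵥ χ) x) ^ 2) (fun x => u x ^ 2) 𝒩
      (Wc := (2 * ((d : ℝ) + 1) / ((side D y : ℝ) ^ 2)) ^ 2)
      (fun x => by
        have h := cutoffT_perLapT_le D y hℓ hMh hP4 x
        rw [← sq_abs]
        exact pow_le_pow_left₀ (abs_nonneg _) h 2)
      (fun x => sq_nonneg _)
      (fun x hx => by
        -- a nonzero second difference sees a nonzero value of `χ` at `x` or at a neighbour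
        have hx' : (perLapT (N0 ℓ Mh k P) *ᵥ χ) x ≠ 0 := fun h => hx (by rw [h]; ring)
        rw [perLapT_mulVec] at hx'
        obtain ⟨μ', -, hμ'⟩ := Finset.exists_ne_zero_of_sum_ne_zero hx'
        by_cases h0 : χ x = 0
        · rw [h0] at hμ'
          by_cases h1 : χ (tshift (N0 ℓ Mh k P) (unitVec μ') x) = 0
          · have h2 : χ (tshift (N0 ℓ Mh k P) (-unitVec μ') x) ≠ 0 := by intro h2; apply hμ'; rw [h1, h2]; ring
            exact hnear x μ' (-1) (by simp) (by rwa [neg_one_smul])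
          · exact hnear x μ' 1 (by simp) (by rwa [one_smul])
        · exact hnear0 x h0)
    exact le_trans (le_of_eq (Finset.sum_congr rfl fun x _ => by ring)) hloc
  have hT4 : ∑ x, (∑ μ' : Fin (d + 1), ((χ (tshift (N0 ℓ Mh k P) (unitVec μ') x) - χ x)
          * (u (tshift (N0 ℓ Mh k P) (unitVec μ') x) - u x)
        + (χ (tshift (N0 ℓ Mh k P) (-unitVec μ') x) - χ x) * (u (tshift (N0 ℓ Mh k P) (-unitVec μ') x) - u x))) ^ 2
      ≤ 4 * ((d : ℝ) + 1) * (2 / (side D y : ℝ)) ^ 2 * ∑ μ' : Fin (d + 1), ∑ s ∈ 𝒩,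
          ∑ x ∈ Finset.univ.filter (fun x => blkOf D.toDomains x = s), ((dT (N0 ℓ Mh k P) μ' *ᵥ u) x) ^ 2 := by
    refine (sum_commB_sq_le (N0 ℓ Mh k P) χ u).trans ?_
    have key : ∀ μ' : Fin (d + 1), ∑ x, (χ (tshift (N0 ℓ Mh k P) (unitVec μ') x) - χ x) ^ 2
        * (u (tshift (N0 ℓ Mh k P) (unitVec μ') x) - u x) ^ 2
        ≤ (2 / (side D y : ℝ)) ^ 2 * ∑ s ∈ 𝒩,
          ∑ x ∈ Finset.univ.filter (fun x => blkOf D.toDomains x = s), ((dT (N0 ℓ Mh k P) μ' *ᵥ u) x) ^ 2 := by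
      intro μ'
      have hloc := sum_weight_le D (fun x => (χ (tshift (N0 ℓ Mh k P) (unitVec μ') x) - χ x) ^ 2)
        (fun x => (u (tshift (N0 ℓ Mh k P) (unitVec μ') x) - u x) ^ 2) 𝒩 (Wc := (2 / (side D y : ℝ)) ^ 2)
        (fun x => by
          have h := cutoffT_lipschitz D y hMh1 hP μ' x
          rw [← sq_abs]
          exact pow_le_pow_left₀ (abs_nonneg _) h 2)
        (fun x => sq_nonneg _)
        (fun x hx => by
          by_cases h0 : χ x = 0
          · have h1 : χ (tshift (N0 ℓ Mh k P) (unitVec μ') x) ≠ 0 := by intro h1; apply hx; rw [h0, h1]; ring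
            exact hnear x μ' 1 (by simp) (by rwa [one_smul])
          · exact hnear0 x h0)
      refine hloc.trans (le_of_eq ?_)
      congr 1
      refine Finset.sum_congr rfl fun s _ => Finset.sum_congr rfl fun x _ => ?_
      rw [dT_mulVec]
    calc 4 * ((d : ℝ) + 1) * ∑ μ' : Fin (d + 1), ∑ x, (χ (tshift (N0 ℓ Mh k P) (unitVec μ') x) - χ x) ^ 2
            * (u (tshift (N0 ℓ Mh k P) (unitVec μ') x) - u x) ^ 2
        ≤ 4 * ((d : ℝ) + 1) * ∑ μ' : Fin (d + 1), ((2 / (side D y : ℝ)) ^ 2 * ∑ s ∈ 𝒩,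
            ∑ x ∈ Finset.univ.filter (fun x => blkOf D.toDomains x = s), ((dT (N0 ℓ Mh k P) μ' *ᵥ u) x) ^ 2) :=
          mul_le_mul_of_nonneg_left (Finset.sum_le_sum fun μ' _ => key μ') (by positivity)
      _ = _ := by rw [← Finset.mul_sum]; ring
  rw [hT1]
  have hT1' : ∑ x, χ x ^ 2 * lam x ^ 2 ≤ ∑ x, cutoffT D y x ^ 2 * lam x ^ 2 := le_rfl
  linarith [hT2, hT3, hT4, hT1']

/-- `(side y : ℝ) = L^j`. [cite: Balaban1984PropagatorsII, (2.1) p.224, dictionary] -/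
theorem side_cast (y : ↥(bset D.toDomains)) : ((side D y : ℕ) : ℝ) = ((ℓ : ℝ) + 1) ^ y.1.1 := by
  unfold side; push_cast; ring

set_option maxHeartbeats 400000 in -- one long assembly of explicit constants (four terms); bookkeeping length, not search
/-- ★★ **(3.46), THE MEMBER `‖h∇∇G′λ‖` AT `U = 1` ON THE GENUINE `k`-LEVEL TORUS** (one-block cut-off ∕ support, squared,
lattice units, prefactor `1`): there are `δ, C, M₀ > 0`, `N₀` (functions of `d, ℓ` and the weight windows) such that for all
`k`, `M_h ≥ 3` with `L·M_h ≥ M₀`, `R ≥ 2L` with `R·L·M_h ≥ N₀ + 1`, torus sizes `P_μ ≥ 4`, families `D`, weights in the windows,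
directions `μ, ν`, blocks `y, y′` and `λ = 0` off `B(y′)`:
`Σ_{x∈B(y)}((∂_μ∂_νG′λ)(x))² ≤ C·e^{−δd(y,y′)}·Σλ²`.
[cite: Balaban1985BackgroundPropagators, Thm 3.1 (3.46) p.398 + Cor. 3.5 p.407; Balaban1984PropagatorsII, Prop. 2.2 (2.67), Lemma 2.1 (2.60)–(2.61) p.234] -/
theorem ineq346_ddGp_flat_multiLevelTorus (d ℓ : ℕ) (hℓ : 1 ≤ ℓ) (aminus aplus a2minus a2plus : ℝ) (ha : 0 < aminus)
    (ha2 : 0 < a2minus) :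
    ∃ δ C M₀ : ℝ, ∃ N₀ : ℕ, 0 < δ ∧ 0 < C ∧ 0 < M₀ ∧ 0 < N₀ ∧
      ∀ (k Mh R : ℕ), 3 ≤ Mh → M₀ ≤ ((ℓ : ℝ) + 1) * Mh → 2 * (ℓ + 1) ≤ R → N₀ + 1 ≤ R * ((ℓ + 1) * Mh) →
      ∀ (P : Fin (d + 1) → ℕ) (hP : ∀ μ, 1 ≤ P μ) (hP4 : ∀ μ, 4 ≤ P μ) (D : TDomains d ℓ Mh k P R) (a c : ℕ → ℝ),
        (∀ i, 1 ≤ i → aminus ≤ a i ∧ a i ≤ aplus) → (∀ i, 1 ≤ i → a2minus ≤ c i ∧ c i ≤ a2plus) →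
        (∀ i, 1 ≤ i → a (i + 1) = aNext ℓ (a i) (c i)) →
      ∀ (μ ν : Fin (d + 1)) (y y' : ↥(bset D.toDomains)) (lam : ↥(boxDom (N0 ℓ Mh k P)) → ℝ),
        (∀ z, blkOf D.toDomains z ≠ y' → lam z = 0) →
        ∑ x ∈ Finset.univ.filter (fun x => blkOf D.toDomains x = y),
            (((dT (N0 ℓ Mh k P) μ * dT (N0 ℓ Mh k P) ν * gmlT (N0 ℓ Mh k P) ℓ k D.lev a) *ᵥ lam) x) ^ 2
          ≤ C * Real.exp (-(δ * (geomT D).dist y y')) * ∑ z, lam z ^ 2 := by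
  classical
  have hL0 : (0 : ℝ) < (ℓ : ℝ) + 1 := by positivity
  have hL1 : (1 : ℝ) ≤ (ℓ : ℝ) + 1 := by linarith [(Nat.cast_nonneg ℓ : (0 : ℝ) ≤ ℓ)]
  -- p21's members 0 and 1, one common rate, Lemma 2.1 at that rate
  obtain ⟨δa, Ca, Ma, Na, hδa, hCa, hMa, -, Ha⟩ := ineq346_Gp_flat_multiLevelTorus d ℓ hℓ aminus aplus a2minus a2plus ha ha2
  obtain ⟨δb, Cb, Mb, Nb, hδb, hCb, hMb, -, Hb⟩ := ineq346_dGp_flat_multiLevelTorus d ℓ hℓ aminus aplus a2minus a2plus ha ha2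
  set δ := min δa δb with hδdef
  have hδ : 0 < δ := lt_min hδa hδb
  obtain ⟨Nq, cq, -, hcq, hconq⟩ := consts_260_261 d ℓ hδ
  set K₀ : ℕ := (d + 1) * (4 * (ℓ + 1) + 1) with hK₀
  set K : ℕ := K₀ + 1 with hKdef
  set CN : ℝ := cq * Real.exp (1 / 4 * δ * K) with hCN
  have hCN0 : 0 ≤ CN := by positivity
  set C : ℝ := 4 * Real.exp (δ * K) * (1 + CN * (aplus ^ 2 * Ca * ((ℓ : ℝ) + 1) ^ 4
    + 4 * ((d : ℝ) + 1) ^ 2 * Ca * ((ℓ : ℝ) + 1) ^ 4 + 16 * ((d : ℝ) + 1) ^ 2 * Cb * ((ℓ : ℝ) + 1) ^ 2)) with hCdef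
  have hC : 0 < C := by positivity
  refine ⟨δ / 4, C, max Ma Mb, max (max Na Nb) (max Nq (K₀ + 3)), by positivity, hC, lt_max_of_lt_left hMa,
    lt_max_of_lt_right (lt_max_of_lt_right (by omega)), ?_⟩
  intro k Mh R hMh hM hR hRN P hP hP4 D a c haw hcw hrec μ ν y y' lam hlam
  have hMh1 : 1 ≤ Mh := le_trans (by norm_num) hMh
  -- thresholds
  have hMa' : Ma ≤ ((ℓ : ℝ) + 1) * Mh := (le_max_left _ _).trans hM
  have hMb' : Mb ≤ ((ℓ : ℝ) + 1) * Mh := (le_max_right _ _).trans hM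
  have hRNa : Na + 1 ≤ R * ((ℓ + 1) * Mh) := le_trans (by simp only [add_le_add_iff_right]; exact (le_max_left _ _).trans (le_max_left _ _)) hRN
  have hRNb : Nb + 1 ≤ R * ((ℓ + 1) * Mh) := le_trans (by simp only [add_le_add_iff_right]; exact (le_max_right _ _).trans (le_max_left _ _)) hRN
  have hRNq : Nq + 1 ≤ R * ((ℓ + 1) * Mh) := le_trans (by simp only [add_le_add_iff_right]; exact (le_max_left _ _).trans (le_max_right _ _)) hRN
  have hRK : K + 1 ≤ R * ((ℓ + 1) * Mh) - 1 := by
    have : K₀ + 3 + 1 ≤ R * ((ℓ + 1) * Mh) := le_trans (by simp only [add_le_add_iff_right]; exact (le_max_right _ _).trans (le_max_right _ _)) hRN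
    omega
  have hRM1 : 1 ≤ R * ((ℓ + 1) * Mh) := le_trans (by omega) hRNq
  obtain ⟨hthr, h261⟩ := hconq k Mh R P hMh1 hP hRNq
  have h261D := h261 D
  -- the repaired weights
  obtain ⟨ha'0, ha'pos, haa', ha'le⟩ := weights_repaired (a := a) ha haw
  set a' : ℕ → ℝ := fun j => if j = 0 then (1 : ℝ) else a j with ha'def
  -- `u = G′λ` and its equation
  set u := gmlT (N0 ℓ Mh k P) ℓ k D.lev a *ᵥ lam with hu
  have hLu : ∀ x, (perLapT (N0 ℓ Mh k P) *ᵥ u) x = lam x - levC d ℓ a' (D.lev x.1)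
      * ∑ z ∈ Finset.univ.filter (fun z => blkOf D.toDomains z = blkOf D.toDomains x), u z :=
    fun x => perLapT_gmlT_apply D hMh1 hP ha'pos haa' lam x
  -- the local estimate
  have hloc := ddGp_local_estimate D hℓ hMh hR hP4 ha'0 μ ν y u lam hLu
  rw [show dT (N0 ℓ Mh k P) μ * dT (N0 ℓ Mh k P) ν * gmlT (N0 ℓ Mh k P) ℓ k D.lev a
      = (dT (N0 ℓ Mh k P) μ * dT (N0 ℓ Mh k P) ν) * gmlT (N0 ℓ Mh k P) ℓ k D.lev a from rfl, ← Matrix.mulVec_mulVec]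
  refine hloc.trans ?_
  -- bookkeeping for the near blocks
  set 𝒩 := Finset.univ.filter (fun s : ↥(bset D.toDomains) => (bondT D).dist s y ≤ (d + 1) * (4 * (ℓ + 1) + 1) + 1) with h𝒩
  set Λ : ℝ := ∑ z, lam z ^ 2 with hΛ
  have hΛ0 : 0 ≤ Λ := Finset.sum_nonneg fun _ _ => sq_nonneg _
  set E : ℝ := Real.exp (δ * K) * Real.exp (-(δ * (geomT D).dist y y')) with hE
  have hE0 : 0 ≤ E := by positivity
  have hdd : 0 ≤ (geomT D).dist y y' := by show (0 : ℝ) ≤ (((bondT D).dist y y' : ℕ) : ℝ); positivity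
  have hmem : ∀ s ∈ 𝒩, (bondT D).dist s y ≤ K := fun s hs => (Finset.mem_filter.1 hs).2
  have hcard : ((𝒩.card : ℕ) : ℝ) ≤ CN := by
    have := card_near_le D (c := cq) (δ := δ) (α := 1 / 4) (by positivity) h261D y K
    exact this
  have hwin : ∀ s ∈ 𝒩, ((ℓ : ℝ) + 1) ^ s.1.1 ≤ ((ℓ : ℝ) + 1) * ((ℓ : ℝ) + 1) ^ y.1.1 ∧
      ((ℓ : ℝ) + 1) ^ y.1.1 ≤ ((ℓ : ℝ) + 1) * ((ℓ : ℝ) + 1) ^ s.1.1 := by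
    intro s hs
    obtain ⟨h1, h2⟩ := scale_window_of_distT_le D hMh1 hP hRK y s (hmem s hs)
    exact pow_window h1 h2
  -- decay of a near block, weakened to the common rate
  have hdec : ∀ s ∈ 𝒩, ∀ δ' : ℝ, δ ≤ δ' →
      Real.exp (-(δ' * (geomT D).dist s y')) ≤ E := by
    intro s hs δ' hδ'
    have hds : 0 ≤ (geomT D).dist s y' := by show (0 : ℝ) ≤ (((bondT D).dist s y' : ℕ) : ℝ); positivity
    calc Real.exp (-(δ' * (geomT D).dist s y')) ≤ Real.exp (-(δ * (geomT D).dist s y')) :=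
          Real.exp_le_exp.2 (by have := mul_le_mul_of_nonneg_right hδ' hds; linarith)
      _ ≤ E := exp_near_le D hMh1 hP hδ.le y y' s (hmem s hs)
  -- p21's bounds on the near blocks
  have hP0 : ∀ s ∈ 𝒩, ∑ x ∈ Finset.univ.filter (fun x => blkOf D.toDomains x = s), u x ^ 2
      ≤ Ca * ((ℓ : ℝ) + 1) ^ (2 * s.1.1) * ((ℓ : ℝ) + 1) ^ (2 * y'.1.1) * E * Λ := by
    intro s hs
    have h := Ha k Mh R hMh hMa' hR hRNa P hP hP4 D a c haw hcw hrec s y' lam hlam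
    refine h.trans ?_
    have := hdec s hs δa (min_le_left _ _)
    have h0 : 0 ≤ Ca * ((ℓ : ℝ) + 1) ^ (2 * s.1.1) * ((ℓ : ℝ) + 1) ^ (2 * y'.1.1) := by positivity
    exact mul_le_mul_of_nonneg_right (mul_le_mul_of_nonneg_left this h0) hΛ0
  have hP1 : ∀ s ∈ 𝒩, ∀ μ' : Fin (d + 1),
      ∑ x ∈ Finset.univ.filter (fun x => blkOf D.toDomains x = s), ((dT (N0 ℓ Mh k P) μ' *ᵥ u) x) ^ 2
        ≤ Cb * ((ℓ : ℝ) + 1) ^ s.1.1 * ((ℓ : ℝ) + 1) ^ y'.1.1 * E * Λ := by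
    intro s hs μ'
    have h := Hb k Mh R hMh hMb' hR hRNb P hP hP4 D a c haw hcw hrec μ' s y' lam hlam
    rw [hu]
    simp only [Matrix.mulVec_mulVec]
    refine h.trans ?_
    have := hdec s hs δb (min_le_right _ _)
    have h0 : 0 ≤ Cb * ((ℓ : ℝ) + 1) ^ s.1.1 * ((ℓ : ℝ) + 1) ^ y'.1.1 := by positivity
    exact mul_le_mul_of_nonneg_right (mul_le_mul_of_nonneg_left this h0) hΛ0
  -- the (2.60) transfers `L^{2j′} e^{−δd} ≤ L² L^{2j} e^{−δd/4}` and `L^{j′} e^{−δd} ≤ L L^{j} e^{−δd/4}`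
  have hX : 0 ≤ (R : ℝ) * (((ℓ : ℝ) + 1) * Mh) - 1 := by
    have : (1 : ℝ) ≤ (R : ℝ) * (((ℓ : ℝ) + 1) * Mh) := by exact_mod_cast hRM1
    linarith
  have hthr' : ∀ m : ℝ, |m| ≤ 2 → ((ℓ : ℝ) + 1) ^ |m| ≤ Real.exp (3 / 4 * δ * ((R : ℝ) * (((ℓ : ℝ) + 1) * Mh) - 1)) := by
    intro m hm
    calc ((ℓ : ℝ) + 1) ^ |m| ≤ ((ℓ : ℝ) + 1) ^ (2 : ℝ) := Real.rpow_le_rpow_of_exponent_le hL1 hm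
      _ = ((ℓ : ℝ) + 1) ^ 2 := by norm_cast
      _ ≤ _ := hthr
      _ ≤ _ := Real.exp_le_exp.2 (by have := mul_nonneg hδ.le hX; linarith)
  have htr2 : ((ℓ : ℝ) + 1) ^ (2 * y'.1.1) * Real.exp (-(δ * (geomT D).dist y y'))
      ≤ ((ℓ : ℝ) + 1) ^ 2 * ((ℓ : ℝ) + 1) ^ (2 * y.1.1) * Real.exp (-(δ / 4 * (geomT D).dist y y')) := by
    have h := transfer_rpow D hMh1 hP hRM1 hδ.le (2 : ℝ) (hthr' 2 (by norm_num)) y y'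
    rw [show |(2 : ℝ)| = 2 by norm_num, Real.rpow_two,
      show (2 : ℝ) * (y'.1.1 : ℝ) = ((2 * y'.1.1 : ℕ) : ℝ) by push_cast; ring,
      show (2 : ℝ) * (y.1.1 : ℝ) = ((2 * y.1.1 : ℕ) : ℝ) by push_cast; ring, Real.rpow_natCast, Real.rpow_natCast] at h
    have hsplit : Real.exp (-(δ * (geomT D).dist y y'))
        = Real.exp (-(3 / 4 * δ * (geomT D).dist y y')) * Real.exp (-(δ / 4 * (geomT D).dist y y')) := by
      rw [← Real.exp_add]; congr 1; ring
    rw [hsplit, ← mul_assoc, mul_comm (((ℓ : ℝ) + 1) ^ (2 * y'.1.1))]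
    exact mul_le_mul_of_nonneg_right h (Real.exp_pos _).le
  have htr1 : ((ℓ : ℝ) + 1) ^ y'.1.1 * Real.exp (-(δ * (geomT D).dist y y'))
      ≤ ((ℓ : ℝ) + 1) * ((ℓ : ℝ) + 1) ^ y.1.1 * Real.exp (-(δ / 4 * (geomT D).dist y y')) := by
    have h := transfer_rpow D hMh1 hP hRM1 hδ.le (1 : ℝ) (hthr' 1 (by norm_num)) y y'
    rw [show |(1 : ℝ)| = 1 by norm_num, Real.rpow_one, one_mul, one_mul, Real.rpow_natCast, Real.rpow_natCast] at h
    have hsplit : Real.exp (-(δ * (geomT D).dist y y'))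
        = Real.exp (-(3 / 4 * δ * (geomT D).dist y y')) * Real.exp (-(δ / 4 * (geomT D).dist y y')) := by
      rw [← Real.exp_add]; congr 1; ring
    rw [hsplit, ← mul_assoc, mul_comm (((ℓ : ℝ) + 1) ^ y'.1.1)]
    exact mul_le_mul_of_nonneg_right h (Real.exp_pos _).le
  -- abbreviations
  set F : ℝ := Real.exp (-(δ / 4 * (geomT D).dist y y')) with hF
  have hF0 : 0 ≤ F := (Real.exp_pos _).le
  have hLj : (0 : ℝ) < ((ℓ : ℝ) + 1) ^ y.1.1 := by positivity
  have hside : ((side D y : ℕ) : ℝ) = ((ℓ : ℝ) + 1) ^ y.1.1 := side_cast D y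
  -- TERM 1: `Σχ²λ² ≤ e^{δK} F Λ`
  have hT1 : ∑ x, cutoffT D y x ^ 2 * lam x ^ 2 ≤ Real.exp (δ * K) * F * Λ := by
    by_cases hy' : (bondT D).dist y' y ≤ K
    · have h1 : ∑ x, cutoffT D y x ^ 2 * lam x ^ 2 ≤ Λ := by
        rw [hΛ]
        refine Finset.sum_le_sum fun x _ => ?_
        have h0 := cutoffT_nonneg D y x; have h1 := cutoffT_le_one D y x
        have : cutoffT D y x ^ 2 ≤ 1 := pow_le_one₀ h0 h1
        exact (mul_le_mul_of_nonneg_right this (sq_nonneg _)).trans_eq (one_mul _)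
      have h2 : (1 : ℝ) ≤ Real.exp (δ * K) * F := by
        have := exp_near_le D hMh1 hP hδ.le y y' y' hy'
        rw [show (geomT D).dist y' y' = 0 by show (((bondT D).dist y' y' : ℕ) : ℝ) = 0; simp, mul_zero, neg_zero,
          Real.exp_zero] at this
        refine this.trans (mul_le_mul_of_nonneg_left (Real.exp_le_exp.2 ?_) (Real.exp_pos _).le)
        have := mul_nonneg hδ.le hdd; linarith
      calc ∑ x, cutoffT D y x ^ 2 * lam x ^ 2 ≤ Λ := h1
        _ = 1 * Λ := (one_mul _).symm
        _ ≤ _ := mul_le_mul_of_nonneg_right h2 hΛ0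
    · have h0 : ∑ x, cutoffT D y x ^ 2 * lam x ^ 2 = 0 := by
        refine Finset.sum_eq_zero fun x _ => ?_
        by_cases hl : lam x = 0
        · rw [hl]; ring
        · have hxy' : blkOf D.toDomains x = y' := by by_contra h; exact hl (hlam x h)
          have hχ : cutoffT D y x = 0 := by
            by_contra hne
            have := distT_le_of_cutoffT_ne_zero D y hℓ hMh hR hP4 hne
            rw [hxy'] at this
            exact hy' (this.trans (Nat.le_succ _))
          rw [hχ]; ring
      rw [h0]; positivity
  -- TERM 2
  have hT2 : ∑ s ∈ 𝒩, (a' s.1.1 * ((((ℓ : ℝ) + 1) ^ s.1.1) ^ 2)⁻¹) ^ 2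
        * ∑ x ∈ Finset.univ.filter (fun x => blkOf D.toDomains x = s), u x ^ 2
      ≤ CN * (aplus ^ 2 * Ca * ((ℓ : ℝ) + 1) ^ 4) * (Real.exp (δ * K) * F * Λ) := by
    have hterm : ∀ s ∈ 𝒩, (a' s.1.1 * ((((ℓ : ℝ) + 1) ^ s.1.1) ^ 2)⁻¹) ^ 2
        * ∑ x ∈ Finset.univ.filter (fun x => blkOf D.toDomains x = s), u x ^ 2
        ≤ aplus ^ 2 * Ca * ((ℓ : ℝ) + 1) ^ 4 * (Real.exp (δ * K) * F * Λ) := by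
      intro s hs
      have hs1 : 1 ≤ s.1.1 := (scale_bounds D.toDomains s).1
      have hale : a' s.1.1 ≤ aplus := ha'le s.1.1 hs1
      have ha0 : 0 ≤ a' s.1.1 := ha'0 s.1.1
      have hLs : (0 : ℝ) < ((ℓ : ℝ) + 1) ^ s.1.1 := by positivity
      obtain ⟨hw1, hw2⟩ := hwin s hs
      have hp0 := hP0 s hs
      -- `(a′L^{−2j_s})²·Ca L^{2j_s}L^{2j′}EΛ = a′² Ca L^{2j′} L^{−2j_s} EΛ ≤ aplus² Ca L² (L^{2j′}/L^{2j}) E Λ`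
      have e1 : (a' s.1.1 * ((((ℓ : ℝ) + 1) ^ s.1.1) ^ 2)⁻¹) ^ 2 * (Ca * ((ℓ : ℝ) + 1) ^ (2 * s.1.1)
          * ((ℓ : ℝ) + 1) ^ (2 * y'.1.1) * E * Λ)
          = a' s.1.1 ^ 2 * Ca * (((ℓ : ℝ) + 1) ^ (2 * y'.1.1) * ((((ℓ : ℝ) + 1) ^ s.1.1) ^ 2)⁻¹) * E * Λ := by
        rw [pow_mul' ((ℓ : ℝ) + 1) 2 s.1.1]; field_simp; try ring
      have hq : ((ℓ : ℝ) + 1) ^ (2 * y'.1.1) * ((((ℓ : ℝ) + 1) ^ s.1.1) ^ 2)⁻¹ * E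
          ≤ ((ℓ : ℝ) + 1) ^ 4 * (Real.exp (δ * K) * F) := by
        -- `L^{2j} ≤ L² L^{2j_s}`
        have hw2' : ((ℓ : ℝ) + 1) ^ (2 * y.1.1) ≤ ((ℓ : ℝ) + 1) ^ 2 * (((ℓ : ℝ) + 1) ^ s.1.1) ^ 2 := by
          rw [pow_mul' ((ℓ : ℝ) + 1) 2 y.1.1, ← mul_pow]; exact pow_le_pow_left₀ hLj.le hw2 2
        rw [hE]
        calc ((ℓ : ℝ) + 1) ^ (2 * y'.1.1) * ((((ℓ : ℝ) + 1) ^ s.1.1) ^ 2)⁻¹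
              * (Real.exp (δ * K) * Real.exp (-(δ * (geomT D).dist y y')))
            = Real.exp (δ * K) * ((((ℓ : ℝ) + 1) ^ s.1.1) ^ 2)⁻¹
              * (((ℓ : ℝ) + 1) ^ (2 * y'.1.1) * Real.exp (-(δ * (geomT D).dist y y'))) := by ring
          _ ≤ Real.exp (δ * K) * ((((ℓ : ℝ) + 1) ^ s.1.1) ^ 2)⁻¹
              * (((ℓ : ℝ) + 1) ^ 2 * ((ℓ : ℝ) + 1) ^ (2 * y.1.1) * F) :=
              mul_le_mul_of_nonneg_left htr2 (by positivity)
          _ ≤ Real.exp (δ * K) * ((((ℓ : ℝ) + 1) ^ s.1.1) ^ 2)⁻¹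
              * (((ℓ : ℝ) + 1) ^ 2 * (((ℓ : ℝ) + 1) ^ 2 * (((ℓ : ℝ) + 1) ^ s.1.1) ^ 2) * F) :=
              mul_le_mul_of_nonneg_left (mul_le_mul_of_nonneg_right
                (mul_le_mul_of_nonneg_left hw2' (by positivity)) hF0) (by positivity)
          _ = ((ℓ : ℝ) + 1) ^ 4 * (Real.exp (δ * K) * F) := by field_simp; try ring
      calc _ ≤ (a' s.1.1 * ((((ℓ : ℝ) + 1) ^ s.1.1) ^ 2)⁻¹) ^ 2 * (Ca * ((ℓ : ℝ) + 1) ^ (2 * s.1.1)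
            * ((ℓ : ℝ) + 1) ^ (2 * y'.1.1) * E * Λ) := mul_le_mul_of_nonneg_left hp0 (sq_nonneg _)
        _ = a' s.1.1 ^ 2 * Ca * (((ℓ : ℝ) + 1) ^ (2 * y'.1.1) * ((((ℓ : ℝ) + 1) ^ s.1.1) ^ 2)⁻¹ * E) * Λ := by
            rw [e1]; ring
        _ ≤ aplus ^ 2 * Ca * (((ℓ : ℝ) + 1) ^ 4 * (Real.exp (δ * K) * F)) * Λ := by
            have h1 : a' s.1.1 ^ 2 * Ca ≤ aplus ^ 2 * Ca :=
              mul_le_mul_of_nonneg_right (pow_le_pow_left₀ ha0 hale 2) hCa.le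
            exact mul_le_mul_of_nonneg_right (mul_le_mul h1 hq (by positivity) (by positivity)) hΛ0
        _ = _ := by ring
    calc _ ≤ ∑ _s ∈ 𝒩, aplus ^ 2 * Ca * ((ℓ : ℝ) + 1) ^ 4 * (Real.exp (δ * K) * F * Λ) := Finset.sum_le_sum hterm
      _ = (𝒩.card : ℝ) * (aplus ^ 2 * Ca * ((ℓ : ℝ) + 1) ^ 4 * (Real.exp (δ * K) * F * Λ)) := by
          rw [Finset.sum_const, nsmul_eq_mul]
      _ ≤ CN * (aplus ^ 2 * Ca * ((ℓ : ℝ) + 1) ^ 4 * (Real.exp (δ * K) * F * Λ)) :=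
          mul_le_mul_of_nonneg_right hcard (by positivity)
      _ = _ := by ring
  -- TERM 3
  have hT3 : (2 * ((d : ℝ) + 1) / ((side D y : ℝ) ^ 2)) ^ 2
        * ∑ s ∈ 𝒩, ∑ x ∈ Finset.univ.filter (fun x => blkOf D.toDomains x = s), u x ^ 2
      ≤ CN * (4 * ((d : ℝ) + 1) ^ 2 * Ca * ((ℓ : ℝ) + 1) ^ 4) * (Real.exp (δ * K) * F * Λ) := by
    rw [hside]
    have hterm : ∀ s ∈ 𝒩, (2 * ((d : ℝ) + 1) / ((((ℓ : ℝ) + 1) ^ y.1.1) ^ 2)) ^ 2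
        * ∑ x ∈ Finset.univ.filter (fun x => blkOf D.toDomains x = s), u x ^ 2
        ≤ 4 * ((d : ℝ) + 1) ^ 2 * Ca * ((ℓ : ℝ) + 1) ^ 4 * (Real.exp (δ * K) * F * Λ) := by
      intro s hs
      obtain ⟨hw1, hw2⟩ := hwin s hs
      have hp0 := hP0 s hs
      have hw1' : ((ℓ : ℝ) + 1) ^ (2 * s.1.1) ≤ ((ℓ : ℝ) + 1) ^ 2 * ((ℓ : ℝ) + 1) ^ (2 * y.1.1) := by
        rw [pow_mul' ((ℓ : ℝ) + 1) 2 s.1.1, pow_mul' ((ℓ : ℝ) + 1) 2 y.1.1, ← mul_pow]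
        exact pow_le_pow_left₀ (by positivity) hw1 2
      have hq : ((ℓ : ℝ) + 1) ^ (2 * s.1.1) * ((ℓ : ℝ) + 1) ^ (2 * y'.1.1) * E
          ≤ ((ℓ : ℝ) + 1) ^ 4 * (((ℓ : ℝ) + 1) ^ y.1.1) ^ 4 * (Real.exp (δ * K) * F) := by
        rw [hE]
        calc ((ℓ : ℝ) + 1) ^ (2 * s.1.1) * ((ℓ : ℝ) + 1) ^ (2 * y'.1.1)
              * (Real.exp (δ * K) * Real.exp (-(δ * (geomT D).dist y y')))
            = Real.exp (δ * K) * ((ℓ : ℝ) + 1) ^ (2 * s.1.1)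
              * (((ℓ : ℝ) + 1) ^ (2 * y'.1.1) * Real.exp (-(δ * (geomT D).dist y y'))) := by ring
          _ ≤ Real.exp (δ * K) * (((ℓ : ℝ) + 1) ^ 2 * ((ℓ : ℝ) + 1) ^ (2 * y.1.1))
              * (((ℓ : ℝ) + 1) ^ 2 * ((ℓ : ℝ) + 1) ^ (2 * y.1.1) * F) :=
              mul_le_mul (mul_le_mul_of_nonneg_left hw1' (by positivity)) htr2 (by positivity) (by positivity)
          _ = ((ℓ : ℝ) + 1) ^ 4 * (((ℓ : ℝ) + 1) ^ y.1.1) ^ 4 * (Real.exp (δ * K) * F) := by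
              rw [pow_mul' ((ℓ : ℝ) + 1) 2 y.1.1]; ring
      calc _ ≤ (2 * ((d : ℝ) + 1) / ((((ℓ : ℝ) + 1) ^ y.1.1) ^ 2)) ^ 2 * (Ca * ((ℓ : ℝ) + 1) ^ (2 * s.1.1)
            * ((ℓ : ℝ) + 1) ^ (2 * y'.1.1) * E * Λ) := mul_le_mul_of_nonneg_left hp0 (sq_nonneg _)
        _ = (2 * ((d : ℝ) + 1)) ^ 2 * Ca * ((((ℓ : ℝ) + 1) ^ y.1.1) ^ 4)⁻¹
            * (((ℓ : ℝ) + 1) ^ (2 * s.1.1) * ((ℓ : ℝ) + 1) ^ (2 * y'.1.1) * E) * Λ := by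
            field_simp; try ring
        _ ≤ (2 * ((d : ℝ) + 1)) ^ 2 * Ca * ((((ℓ : ℝ) + 1) ^ y.1.1) ^ 4)⁻¹
            * (((ℓ : ℝ) + 1) ^ 4 * (((ℓ : ℝ) + 1) ^ y.1.1) ^ 4 * (Real.exp (δ * K) * F)) * Λ :=
            mul_le_mul_of_nonneg_right (mul_le_mul_of_nonneg_left hq (by positivity)) hΛ0
        _ = _ := by field_simp; try ring
    rw [Finset.mul_sum]
    calc ∑ s ∈ 𝒩, (2 * ((d : ℝ) + 1) / ((((ℓ : ℝ) + 1) ^ y.1.1) ^ 2)) ^ 2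
          * ∑ x ∈ Finset.univ.filter (fun x => blkOf D.toDomains x = s), u x ^ 2
        ≤ ∑ _s ∈ 𝒩, 4 * ((d : ℝ) + 1) ^ 2 * Ca * ((ℓ : ℝ) + 1) ^ 4 * (Real.exp (δ * K) * F * Λ) :=
          Finset.sum_le_sum hterm
      _ = (𝒩.card : ℝ) * (4 * ((d : ℝ) + 1) ^ 2 * Ca * ((ℓ : ℝ) + 1) ^ 4 * (Real.exp (δ * K) * F * Λ)) := by
          rw [Finset.sum_const, nsmul_eq_mul]
      _ ≤ CN * (4 * ((d : ℝ) + 1) ^ 2 * Ca * ((ℓ : ℝ) + 1) ^ 4 * (Real.exp (δ * K) * F * Λ)) :=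
          mul_le_mul_of_nonneg_right hcard (by positivity)
      _ = _ := by ring
  -- TERM 4
  have hT4 : 4 * ((d : ℝ) + 1) * (2 / (side D y : ℝ)) ^ 2 * ∑ μ' : Fin (d + 1), ∑ s ∈ 𝒩,
        ∑ x ∈ Finset.univ.filter (fun x => blkOf D.toDomains x = s), ((dT (N0 ℓ Mh k P) μ' *ᵥ u) x) ^ 2
      ≤ CN * (16 * ((d : ℝ) + 1) ^ 2 * Cb * ((ℓ : ℝ) + 1) ^ 2) * (Real.exp (δ * K) * F * Λ) := by
    rw [hside]
    have hterm : ∀ μ' : Fin (d + 1), ∀ s ∈ 𝒩,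
        ∑ x ∈ Finset.univ.filter (fun x => blkOf D.toDomains x = s), ((dT (N0 ℓ Mh k P) μ' *ᵥ u) x) ^ 2
        ≤ Cb * ((ℓ : ℝ) + 1) ^ 2 * (((ℓ : ℝ) + 1) ^ y.1.1) ^ 2 * (Real.exp (δ * K) * F * Λ) := by
      intro μ' s hs
      obtain ⟨hw1, hw2⟩ := hwin s hs
      refine (hP1 s hs μ').trans ?_
      rw [hE]
      calc Cb * ((ℓ : ℝ) + 1) ^ s.1.1 * ((ℓ : ℝ) + 1) ^ y'.1.1
            * (Real.exp (δ * K) * Real.exp (-(δ * (geomT D).dist y y'))) * Λ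
          = Cb * Real.exp (δ * K) * ((ℓ : ℝ) + 1) ^ s.1.1
            * (((ℓ : ℝ) + 1) ^ y'.1.1 * Real.exp (-(δ * (geomT D).dist y y'))) * Λ := by ring
        _ ≤ Cb * Real.exp (δ * K) * (((ℓ : ℝ) + 1) * ((ℓ : ℝ) + 1) ^ y.1.1)
            * (((ℓ : ℝ) + 1) * ((ℓ : ℝ) + 1) ^ y.1.1 * F) * Λ :=
            mul_le_mul_of_nonneg_right (mul_le_mul (mul_le_mul_of_nonneg_left hw1 (by positivity)) htr1
              (by positivity) (by positivity)) hΛ0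
        _ = _ := by ring
    have hsum : ∑ μ' : Fin (d + 1), ∑ s ∈ 𝒩,
        ∑ x ∈ Finset.univ.filter (fun x => blkOf D.toDomains x = s), ((dT (N0 ℓ Mh k P) μ' *ᵥ u) x) ^ 2
        ≤ ((d : ℝ) + 1) * (CN * (Cb * ((ℓ : ℝ) + 1) ^ 2 * (((ℓ : ℝ) + 1) ^ y.1.1) ^ 2 * (Real.exp (δ * K) * F * Λ))) := by
      calc _ ≤ ∑ _μ' : Fin (d + 1), (𝒩.card : ℝ) * (Cb * ((ℓ : ℝ) + 1) ^ 2 * (((ℓ : ℝ) + 1) ^ y.1.1) ^ 2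
            * (Real.exp (δ * K) * F * Λ)) := by
            refine Finset.sum_le_sum fun μ' _ => ?_
            calc _ ≤ ∑ _s ∈ 𝒩, Cb * ((ℓ : ℝ) + 1) ^ 2 * (((ℓ : ℝ) + 1) ^ y.1.1) ^ 2 * (Real.exp (δ * K) * F * Λ) :=
                  Finset.sum_le_sum (hterm μ')
              _ = _ := by rw [Finset.sum_const, nsmul_eq_mul]
        _ ≤ ∑ _μ' : Fin (d + 1), CN * (Cb * ((ℓ : ℝ) + 1) ^ 2 * (((ℓ : ℝ) + 1) ^ y.1.1) ^ 2
            * (Real.exp (δ * K) * F * Λ)) :=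
            Finset.sum_le_sum fun μ' _ => mul_le_mul_of_nonneg_right hcard (by positivity)
        _ = _ := by rw [Finset.sum_const, Finset.card_univ, Fintype.card_fin, nsmul_eq_mul]; push_cast; ring
    calc _ ≤ 4 * ((d : ℝ) + 1) * (2 / ((ℓ : ℝ) + 1) ^ y.1.1) ^ 2
          * (((d : ℝ) + 1) * (CN * (Cb * ((ℓ : ℝ) + 1) ^ 2 * (((ℓ : ℝ) + 1) ^ y.1.1) ^ 2 * (Real.exp (δ * K) * F * Λ)))) :=
          mul_le_mul_of_nonneg_left hsum (by positivity)
      _ = _ := by field_simp; try ring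
  -- assembly
  have hsum4 := add_le_add (add_le_add (add_le_add hT1 hT2) hT3) hT4
  refine (mul_le_mul_of_nonneg_left hsum4 (by norm_num : (0 : ℝ) ≤ 4)).trans (le_of_eq ?_)
  rw [hCdef]
  ring

end MemberDD



/-! ## §4 The member `G′∂_μᵀ∂_νᵀ = (∂_ν∂_μG′)ᵀ` by duality -/

section MemberGdd

/-- ★★ **(3.46), THE MEMBER `‖hG′∇*∇*λ‖` AT `U = 1` ON THE GENUINE `k`-LEVEL TORUS** — the transpose of the member
`∇∇G′` (`G′` symmetric, all shifts commute; `B9Ineq346SecondOrderTorusCore.transpose_block_bound`), same constants.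
[cite: Balaban1985BackgroundPropagators, Thm 3.1 (3.46) p.398 («we may always replace ∇_U by ∇*_U») + Cor. 3.5 p.407; Balaban1984PropagatorsII, Prop. 2.2 (2.67), Lemma 2.1 p.234] -/
theorem ineq346_Gpdd_flat_multiLevelTorus (d ℓ : ℕ) (hℓ : 1 ≤ ℓ) (aminus aplus a2minus a2plus : ℝ) (ha : 0 < aminus)
    (ha2 : 0 < a2minus) :
    ∃ δ C M₀ : ℝ, ∃ N₀ : ℕ, 0 < δ ∧ 0 < C ∧ 0 < M₀ ∧ 0 < N₀ ∧
      ∀ (k Mh R : ℕ), 3 ≤ Mh → M₀ ≤ ((ℓ : ℝ) + 1) * Mh → 2 * (ℓ + 1) ≤ R → N₀ + 1 ≤ R * ((ℓ + 1) * Mh) →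
      ∀ (P : Fin (d + 1) → ℕ) (hP : ∀ μ, 1 ≤ P μ) (hP4 : ∀ μ, 4 ≤ P μ) (D : TDomains d ℓ Mh k P R) (a c : ℕ → ℝ),
        (∀ i, 1 ≤ i → aminus ≤ a i ∧ a i ≤ aplus) → (∀ i, 1 ≤ i → a2minus ≤ c i ∧ c i ≤ a2plus) →
        (∀ i, 1 ≤ i → a (i + 1) = aNext ℓ (a i) (c i)) →
      ∀ (μ ν : Fin (d + 1)) (y y' : ↥(bset D.toDomains)) (lam : ↥(boxDom (N0 ℓ Mh k P)) → ℝ),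
        (∀ z, blkOf D.toDomains z ≠ y' → lam z = 0) →
        ∑ x ∈ Finset.univ.filter (fun x => blkOf D.toDomains x = y),
            (((gmlT (N0 ℓ Mh k P) ℓ k D.lev a * (dT (N0 ℓ Mh k P) μ)ᵀ * (dT (N0 ℓ Mh k P) ν)ᵀ) *ᵥ lam) x) ^ 2
          ≤ C * Real.exp (-(δ * (geomT D).dist y y')) * ∑ z, lam z ^ 2 := by
  classical
  obtain ⟨δ, C, M₀, N₀, hδ, hC, hM₀, hN₀, H⟩ := ineq346_ddGp_flat_multiLevelTorus d ℓ hℓ aminus aplus a2minus a2plus ha ha2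
  refine ⟨δ, C, M₀, N₀, hδ, hC, hM₀, hN₀, ?_⟩
  intro k Mh R hMh hM hR hRN P hP hP4 D a c haw hcw hrec μ ν y y' lam hlam
  have hT : gmlT (N0 ℓ Mh k P) ℓ k D.lev a * (dT (N0 ℓ Mh k P) μ)ᵀ * (dT (N0 ℓ Mh k P) ν)ᵀ
      = (dT (N0 ℓ Mh k P) ν * dT (N0 ℓ Mh k P) μ * gmlT (N0 ℓ Mh k P) ℓ k D.lev a)ᵀ := by
    rw [Matrix.transpose_mul, Matrix.transpose_mul, gmlT_isSymm.eq, Matrix.mul_assoc]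
  have hdist : (geomT D).dist y y' = (geomT D).dist y' y := by
    show (((bondT D).dist y y' : ℕ) : ℝ) = (((bondT D).dist y' y : ℕ) : ℝ); rw [SimpleGraph.dist_comm]
  rw [hT, hdist]
  refine transpose_block_bound (dT (N0 ℓ Mh k P) ν * dT (N0 ℓ Mh k P) μ * gmlT (N0 ℓ Mh k P) ℓ k D.lev a)
    (Finset.univ.filter (fun x => blkOf D.toDomains x = y)) (Finset.univ.filter (fun x => blkOf D.toDomains x = y'))
    (by positivity) (fun g hg => ?_) lam (fun z hz => hlam z fun h => hz (Finset.mem_filter.2 ⟨Finset.mem_univ _, h⟩))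
  exact H k Mh R hMh hM hR hRN P hP hP4 D a c haw hcw hrec ν μ y' y g
    (fun z hz => hg z fun h => hz (Finset.mem_filter.1 h).2)

end MemberGdd

end Literature.MathematicalPhysics.QuantumFieldTheory.Balaban1983to89.B9Ineq346SecondOrderFlatMultiLevelTorus

end
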